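import Summits.AtomisticToContinuum.Crystallization.Theorems.FrustratedLawDichotomyStrainedPatchHomEntrySixHcpSharp

/-!
# The reflected (P2′) RADIAL-BAD prune on hcp entry/shuffle boxes: «some neighbour at `[(9/8), 13/10)·d₀` ⟹ the centre is `1/8`-BAD ⟹ the hcp prune»

decomp-a2c hand-2 g23 (crux `AperiodicFrustratedLawGap`, stmt-AtomisticToContinuum-27623; the hcp twin of hand-1 g21's `…HomEntryRadial`).
Critic row 851: both floor checkers cap the accepted entry half-width INDEPENDENTLY of the margin, so the outer region of the cube (`‖U − 1‖ ≤ 1/4`,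
`‖ξ‖ ≤ 1/4` — most of it `1/8`-BAD with a huge floor margin) must be removed by a prune that fires on COARSE boxes; hand-1 supplied it for the fcc
family (`radOK`), the hcp family (twelve coordinates, three of them the shuffle) had none.  The rotation-free radial obstruction
`…CellKitF.not_goodAtScale_of_radial` (nearest-neighbour distance `d₀` pinned and a point of the cluster at distance in `[(1 + η) d₀, 13/10·d₀)` ⟹ not
`η`-good for ANY isometry / assignment) applies verbatim to hcp balls:

* §1 ★ `pruneHcp_of_radialBad` (real side): every non-zero point of `U·(L_hex ∪ (L_hex + hcpShift + ξ))` has norm `≥ d₀`, one has norm `≤ d₀`, and one has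
  norm in `[(9/8) d₀, (13/10) d₀)` (both shorter than `15/2`) ⟹ `BadNearCap (9/5) (3/2)` at the centre of every realisation;
* §2 ★ the kernel verdict `radOKH c w` on a twelve-coordinate box (`q_k = nbrSq c w k ∋ ‖nbrU k‖²` from hand-2 g22's kit, `Dhi/Dlo` = min over the
  twelve neighbours of the upper/lower ends; pin check `Dhi ≤ (qform13 …).lo` for every non-neighbour label of `[−7,7]³` in both families; the
  labels outside the cube are pinned by the tail `‖·‖ ≥ 4.3 > 5/4 ≥ d₀`; `‖ξ‖ ≤ 1/2`; witness `k` with `81·Dhi ≤ 64·q_k.lo ∧ 100·q_k.hi < 169·Dlo`);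
  ★★ `radOKH_sound`;
* §3 the verdicts `entryLeafOKH3R μ := radOKH ∘ symH ∨ entryLeafOKH3s μ` (radial ∨ sharp fit ∨ fit ∨ symmetry ∨ column ∨ (P4), nine free coordinates)
  with soundness, `hcpHalf_of_entrySearchH3R`, and ★★★ `homFloor_625_of_entrySearches6R3R` (fcc `entryLeafOK6R` × hcp `entryLeafOKH3R`),
  `homFloor_625_of_entrySearches6RB3R` (fcc `entryLeafOK6RB`) + generic and `1/1000` forms; §4 kernel smoke test.

One kernel definition + one verdict; 0 sorry; standard axioms; no instances / notation / `#eval`.  `--supports stmt-AtomisticToContinuum-27623`.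
-/

namespace Summit.AtomisticToContinuum.Crystallization.Theorems.FrustratedLawDichotomyStrainedPatchHomEntryRadialHcp

open scoped BigOperators RealInnerProductSpace
open Literature.Analysis.ValidatedNumerics.Numerics
open Summit.AtomisticToContinuum.Crystallization.Theorems.ChargedEnergyGapNegative (E3)
open Summit.AtomisticToContinuum.Crystallization.Theorems.FrustratedLawDichotomySchurCut (effPot w₄₅ ω₄)
open Summit.AtomisticToContinuum.Crystallization.Theorems.FrustratedLawDichotomyAveragingRuleTightFree (TightNearCap BadNearCap)
open Summit.AtomisticToContinuum.Crystallization.Theorems.FrustratedLawDichotomyAveragingCut (self_mem_ball)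
open Summit.AtomisticToContinuum.Crystallization.Theorems.FrustratedLawDichotomyExemptAbsorption (ExemptNear)
open Summit.AtomisticToContinuum.Crystallization.Theorems.FrustratedLawDichotomyStrainedPatchHomSplit
open Summit.AtomisticToContinuum.Crystallization.Theorems.FrustratedLawDichotomyStrainedPatchHomPrunes (locHom_hcp_centre)
open Summit.AtomisticToContinuum.Crystallization.Theorems.FrustratedLawDichotomyStrainedPatchHomPolar
  (norm_apply_ge_of_norm_sub_one_le norm_apply_le_of_norm_sub_one_le)
open Summit.AtomisticToContinuum.Crystallization.Theorems.FrustratedLawDichotomyStrainedPatchHomLatticeBoxHcp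
  (latPt_eq_apply_one shifted_eq_apply mem_box_of_norm_hexPt_lt mem_box_of_norm_hexPt_add_shift_lt)
open Summit.AtomisticToContinuum.Crystallization.Theorems.FrustratedLawDichotomyCellKitF (not_goodAtScale_of_radial)
open Summit.AtomisticToContinuum.Crystallization.Theorems.FrustratedLawDichotomyStrainedPatchHomPrunedPolar (homFloor_of_prunedBoxSums_selfAdjoint)
open Summit.AtomisticToContinuum.Crystallization.Theorems.FrustratedLawDichotomyStrainedPatchHomCertTree (CertTree treeOK)
open Summit.AtomisticToContinuum.Crystallization.Theorems.FrustratedLawDichotomyStrainedPatchHomLeafCheckC (iccC iccC_eq)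
open Summit.AtomisticToContinuum.Crystallization.Theorems.FrustratedLawDichotomyStrainedPatchHomEntryGram
open Summit.AtomisticToContinuum.Crystallization.Theorems.FrustratedLawDichotomyStrainedPatchHomEntryFitKit (lmin lmin_le_of_mem lmin_mem)
open Summit.AtomisticToContinuum.Crystallization.Theorems.FrustratedLawDichotomyStrainedPatchHomEntryGramHcp
open Summit.AtomisticToContinuum.Crystallization.Theorems.FrustratedLawDichotomyStrainedPatchHomEntryHcpFrame
open Summit.AtomisticToContinuum.Crystallization.Theorems.FrustratedLawDichotomyStrainedPatchHomEntryFitHcpKit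
open Summit.AtomisticToContinuum.Crystallization.Theorems.FrustratedLawDichotomyStrainedPatchHomEntryTable (muRec muRec_ok)
open Summit.AtomisticToContinuum.Crystallization.Theorems.FrustratedLawDichotomyStrainedPatchHomEntrySearch
open Summit.AtomisticToContinuum.Crystallization.Theorems.FrustratedLawDichotomyStrainedPatchHomEntrySix (muMilli muMilli_ok)
open Summit.AtomisticToContinuum.Crystallization.Theorems.FrustratedLawDichotomyStrainedPatchHomEntryRadial (entryLeafOK6R fccHalf_of_entrySearch6R)
open Summit.AtomisticToContinuum.Crystallization.Theorems.FrustratedLawDichotomyStrainedPatchHomEntrySymBox (symH hbox_symU entryLeafOKH3s entryLeafOKH3s_sound)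
open Summit.AtomisticToContinuum.Crystallization.Theorems.FrustratedLawDichotomyStrainedPatchHomEntrySixHcpSharp (entryLeafOK6RB fccHalf_of_entrySearch6RB)

/-! ## §1. The real radial-bad prune for hcp balls -/

/-- ★ **RADIAL-BAD PRUNE (real side), hcp.**  If every non-zero point of the deformed hcp structure `U·(L_hex ∪ (L_hex + hcpShift + ξ))` (seen from a
lattice site) has norm `≥ d₀`, some point `v` has `0 < ‖v‖ ≤ d₀`, and some point `w` has `(1 + 1/8) d₀ ≤ ‖w‖ < 13/10·d₀` (both shorter than `15/2`),
then every realisation of the `(U, ξ)`-hcp ball is pruned: its centre is not `1/8`-good at any scale (`…CellKitF.not_goodAtScale_of_radial`). [folklore] -/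
theorem pruneHcp_of_radialBad {U : E3 →L[ℝ] E3} {ξ : E3} {d₀ : ℝ} {v w : E3}
    (hvS : ∃ b : Fin 3 → ℤ, v = latPt U hexFrame b ∨ v = latPt U hexFrame b + U (hcpShift + ξ)) (hv0 : v ≠ 0) (hvd : ‖v‖ ≤ d₀) (hv7 : ‖v‖ < 15 / 2)
    (hpinA : ∀ b : Fin 3 → ℤ, latPt U hexFrame b ≠ 0 → d₀ ≤ ‖latPt U hexFrame b‖)
    (hpinB : ∀ b : Fin 3 → ℤ, d₀ ≤ ‖latPt U hexFrame b + U (hcpShift + ξ)‖)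
    (hwS : ∃ b : Fin 3 → ℤ, w = latPt U hexFrame b ∨ w = latPt U hexFrame b + U (hcpShift + ξ))
    (hw1 : (1 + 1 / 8) * d₀ ≤ ‖w‖) (hw2 : ‖w‖ < 13 / 10 * d₀) (hw7 : ‖w‖ < 15 / 2) :
    ∀ (M : ℕ) (z : Fin M → E3) (c : Fin M), Function.Injective z →
      Set.range z = {x : E3 | dist x (z c) ≤ 133 / 10 ∧ ∃ a : Fin 3 → ℤ,
        x = z c + latPt U hexFrame a ∨ x = z c + latPt U hexFrame a + U (hcpShift + ξ)} →
      TightNearCap (9 / 5) (3 / 2) z c ∨ ExemptNear (9 / 5) ExRec z c ∨ BadNearCap (9 / 5) (3 / 2) z c := by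
  intro M z c _ hrange
  have hT := locHom_hcp_centre hrange
  refine Or.inr (Or.inr ⟨c, self_mem_ball (by norm_num) z c, not_goodAtScale_of_radial (d₀ := d₀) (by norm_num) ?_ ?_ ?_⟩)
  · -- pinning: every other point of the ball is a non-zero structure point away
    intro a hne
    have hmem : z a ∈ Set.range z := ⟨a, rfl⟩
    rw [hrange] at hmem
    obtain ⟨-, b, hb | hb⟩ := hmem
    · have hval : z a - z c = latPt U hexFrame b := by rw [hb]; abel
      have hb0 : latPt U hexFrame b ≠ 0 := by
        intro h0; apply hne; rw [← sub_eq_zero, hval, h0]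
      rw [dist_eq_norm, hval]
      exact hpinA b hb0
    · have hval : z a - z c = latPt U hexFrame b + U (hcpShift + ξ) := by rw [hb]; abel
      rw [dist_eq_norm, hval]
      exact hpinB b
  · -- the nearest point `z c + v`
    obtain ⟨bv, hbv⟩ := hvS
    have hx : z c + v ∈ Set.range z := by
      refine (hT _ (by rwa [dist_eq_norm, add_sub_cancel_left])).2 ⟨bv, ?_⟩
      rw [add_sub_cancel_left]; exact hbv
    obtain ⟨a, ha⟩ := hx
    refine ⟨a, ?_, ?_⟩
    · intro h; apply hv0
      have := congrArg (fun x => x - z c) ha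
      simpa [h] using this.symm
    · rw [dist_eq_norm, ha, add_sub_cancel_left]; exact hvd
  · -- the radially misplaced point `z c + w`
    obtain ⟨bw, hbw⟩ := hwS
    have hx : z c + w ∈ Set.range z := by
      refine (hT _ (by rwa [dist_eq_norm, add_sub_cancel_left])).2 ⟨bw, ?_⟩
      rw [add_sub_cancel_left]; exact hbw
    obtain ⟨a, ha⟩ := hx
    exact ⟨a, by rw [dist_eq_norm, ha, add_sub_cancel_left]; exact hw1, by rw [dist_eq_norm, ha, add_sub_cancel_left]; exact hw2⟩

/-- Every deformed neighbour `nbrU k` is a structure point. [formal bookkeeping] -/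
theorem nbrU_structure (U : E3 →L[ℝ] E3) (ξ : E3) (k : Fin 12) :
    ∃ b : Fin 3 → ℤ, nbrU U ξ k = latPt U hexFrame b ∨ nbrU U ξ k = latPt U hexFrame b + U (hcpShift + ξ) := by
  refine ⟨hlab k, ?_⟩
  cases h : hshift k
  · exact Or.inl (nbrU_of_unshifted h)
  · exact Or.inr (nbrU_of_shifted h)

/-- The first neighbour (`hlab 0 = (−1,0,0)`, family `A`) is at most `5/4` long under `‖U − 1‖ ≤ 1/4`. [folklore] -/
theorem norm_nbrU_zero_le {U : E3 →L[ℝ] E3} (hU : ‖U - 1‖ ≤ 1 / 4) (ξ : E3) : ‖nbrU U ξ 0‖ ≤ 5 / 4 := by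
  have h0 : hshift 0 = false := rfl
  have e : nbrU U ξ 0 = U (nbr 0) := by
    rw [nbrU_of_unshifted h0]; unfold nbr latPt; rw [h0]; simp
  rw [e]
  have := norm_apply_le_of_norm_sub_one_le hU (nbr 0)
  rw [norm_nbr] at this
  linarith

/-! ## §2. The kernel verdict and its soundness -/

/-- ★ **THE hcp RADIAL-BAD VERDICT** on an entry/shuffle box (`q_k = nbrSq c w k ∋ ‖nbrU k‖²`, `Dhi = min_k q_k.hi`, `Dlo = min_k q_k.lo`):
`0 < Dlo`, `‖ξ‖ ≤ 1/2`, every non-neighbour label of `[−7,7]³` pinned at `≥ Dhi` in both families, and a neighbour `k` with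
`(81/64)·Dhi ≤ q_k.lo ∧ q_k.hi < (169/100)·Dlo`. -/
def radOKH (c w : (Fin 3 × Fin 3) ⊕ Fin 3 → ℤ) : Bool :=
  let Dhi := lmin (K12H.map fun k => (nbrSq c w k).hi)
  let Dlo := lmin (K12H.map fun k => (nbrSq c w k).lo)
  decide (0 < Dlo) && decide (4 * (xiSq c w).hi ≤ (SC : ℤ)) &&
  K12H.any (fun k => decide (81 * Dhi ≤ 64 * (nbrSq c w k).lo) && decide (100 * (nbrSq c w k).hi < 169 * Dlo)) &&
  decide (∀ b ∈ box7all,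
    (b = 0 ∨ (∃ k : Fin 12, hshift k = false ∧ hlab k = b) ∨ Dhi ≤ (qform13 (extU c w) b false).lo) ∧
    ((∃ k : Fin 12, hshift k = true ∧ hlab k = b) ∨ Dhi ≤ (qform13 (extU c w) b true).lo))

/-- ★★ **SOUNDNESS OF THE hcp RADIAL-BAD VERDICT**: `radOKH c w = true` ⟹ the hcp prune disjunct for every `U` with `‖U − 1‖ ≤ 1/4` and `ξ` whose
coordinates lie in the box. [folklore] -/
theorem radOKH_sound {c w : (Fin 3 × Fin 3) ⊕ Fin 3 → ℤ} (h : radOKH c w = true) (U : E3 →L[ℝ] E3) (ξ : E3) (hU : ‖U - 1‖ ≤ 1 / 4)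
    (hbox : ∀ ab : Fin 3 × Fin 3, |(U (EuclideanSpace.single ab.2 (1 : ℝ))) ab.1 - (c (Sum.inl ab) : ℝ) / SC| ≤ (w (Sum.inl ab) : ℝ) / SC)
    (hξb : ∀ i : Fin 3, |ξ i - (c (Sum.inr i) : ℝ) / SC| ≤ (w (Sum.inr i) : ℝ) / SC) :
    ∀ (M : ℕ) (z : Fin M → E3) (c : Fin M), Function.Injective z →
      Set.range z = {x : E3 | dist x (z c) ≤ 133 / 10 ∧ ∃ a : Fin 3 → ℤ,
        x = z c + latPt U hexFrame a ∨ x = z c + latPt U hexFrame a + U (hcpShift + ξ)} →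
      TightNearCap (9 / 5) (3 / 2) z c ∨ ExemptNear (9 / 5) ExRec z c ∨ BadNearCap (9 / 5) (3 / 2) z c := by
  classical
  have hS := SC_pos
  simp only [radOKH, Bool.and_eq_true, List.any_eq_true, decide_eq_true_eq] at h
  obtain ⟨⟨⟨hDlo0, hxi4⟩, kw, -, hw1, hw2⟩, hfar⟩ := h
  -- enclosures
  have hE : ∀ ab : Fin 3 × Fin 3, FI.mem ((U (EuclideanSpace.single ab.2 (1 : ℝ))) ab.1) (entU c w ab) := fun ab => mem_entryFI (hbox ab)
  have hX : ∀ i, FI.mem (ξ i) (shufFI c w i) := fun i => mem_shufFI (hξb i)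
  obtain ⟨hUG, hUC, hUT⟩ : (∀ i j, FI.mem ⟪U (hexFrame i), U (hexFrame j)⟫ (extU c w (Sum.inl (i, j)))) ∧
      (∀ i, FI.mem ⟪U (hexFrame i), U (hcpShift + ξ)⟫ (extU c w (Sum.inr (Sum.inl i)))) ∧
      FI.mem (‖U (hcpShift + ξ)‖ ^ 2) (extU c w (Sum.inr (Sum.inr 0))) := mem_extFI U ξ hE hX
  have hnbr : ∀ k, FI.mem (‖nbrU U ξ k‖ ^ 2) (nbrSq c w k) := fun k => by
    have := mem_qform13 U (hcpShift + ξ) hUG hUC hUT (hlab k) (hshift k)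
    unfold nbrU nbrSq; exact this
  -- `‖ξ‖ ≤ 1/2`
  have hxi : FI.mem (‖ξ‖ ^ 2) (xiSq c w) := by
    rw [EuclideanSpace.norm_sq_eq, Fin.sum_univ_three]
    simp only [Real.norm_eq_abs, sq_abs]
    exact FI.mem_add (FI.mem_add (FI.mem_sqr (hX 0)) (FI.mem_sqr (hX 1))) (FI.mem_sqr (hX 2))
  have hξ2 : ‖ξ‖ ≤ 1 / 2 := by
    have h1 := (FI.mem_def.1 hxi).2
    have h2 : (4 : ℝ) * (xiSq c w).hi ≤ SC := by exact_mod_cast hxi4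
    have hsq : ‖ξ‖ ^ 2 ≤ (1 / 2) ^ 2 := by
      have := le_of_mul_le_mul_right (by linarith : ‖ξ‖ ^ 2 * 4 * SC ≤ 1 * SC) hS
      linarith
    exact (abs_le_of_sq_le_sq' hsq (by norm_num)).2
  -- the nearest neighbour `kv` and `d₀`
  obtain ⟨kv, -, hmin⟩ := Finset.exists_min_image Finset.univ (fun k : Fin 12 => ‖nbrU U ξ k‖) Finset.univ_nonempty
  set d₀ := ‖nbrU U ξ kv‖ with hd₀
  have hmin' : ∀ k, d₀ ≤ ‖nbrU U ξ k‖ := fun k => hmin k (Finset.mem_univ k)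
  set Dhi := lmin (K12H.map fun k => (nbrSq c w k).hi) with hDhi_def
  set Dlo := lmin (K12H.map fun k => (nbrSq c w k).lo) with hDlo_def
  -- `Dlo ≤ d₀² SC ≤ Dhi`
  have hDlo : ((Dlo : ℤ) : ℝ) ≤ d₀ ^ 2 * SC := by
    have hle := lmin_le_of_mem (K12H.map fun k => (nbrSq c w k).lo) (nbrSq c w kv).lo (List.mem_map.2 ⟨kv, mem_K12H kv, rfl⟩)
    have := (hnbr kv).1
    calc ((Dlo : ℤ) : ℝ) ≤ (nbrSq c w kv).lo := by exact_mod_cast hle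
      _ ≤ d₀ ^ 2 * SC := this
  have hDhi : d₀ ^ 2 * SC ≤ ((Dhi : ℤ) : ℝ) := by
    have hm := lmin_mem (K12H.map fun k => (nbrSq c w k).hi) (by simp [K12H])
    obtain ⟨k₁, -, hk₁e⟩ := List.mem_map.1 hm
    rw [hDhi_def, ← hk₁e]
    have h2 := (hnbr k₁).2
    have : d₀ ^ 2 ≤ ‖nbrU U ξ k₁‖ ^ 2 := pow_le_pow_left₀ (norm_nonneg _) (hmin' k₁) 2
    nlinarith
  have hd0 : 0 ≤ d₀ := norm_nonneg _
  have hdle : d₀ ≤ 5 / 4 := (hmin' 0).trans (norm_nbrU_zero_le hU ξ)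
  -- `d₀ > 0` from `0 < Dlo`
  have hd0' : 0 < d₀ := by
    have h1 : (0 : ℝ) < Dlo := by exact_mod_cast hDlo0
    have h2 : 0 < d₀ ^ 2 * SC := h1.trans_le hDlo
    have h3 : 0 < d₀ ^ 2 := by
      rcases mul_pos_iff.1 h2 with ⟨h, _⟩ | ⟨_, h⟩
      · exact h
      · exact absurd h (not_lt.2 hS.le)
    have hne0 : d₀ ≠ 0 := by rintro h0; rw [h0] at h3; norm_num at h3
    exact lt_of_le_of_ne hd0 (Ne.symm hne0)
  have hv0 : nbrU U ξ kv ≠ 0 := by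
    intro h0; rw [hd₀, h0, norm_zero] at hd0'; exact lt_irrefl _ hd0'
  -- pinning helper: a lower end `≥ Dhi` pins the point
  have pin_of_lo : ∀ {x : ℝ} {I : FI}, FI.mem (x ^ 2) I → Dhi ≤ I.lo → 0 ≤ x → d₀ ≤ x := by
    intro x I hm hle hx
    have hle' : ((Dhi : ℤ) : ℝ) ≤ (I.lo : ℝ) := by exact_mod_cast hle
    have hsq : d₀ ^ 2 ≤ x ^ 2 := le_of_mul_le_mul_right (hDhi.trans (hle'.trans hm.1)) hS
    exact (abs_le_of_sq_le_sq' hsq hx).2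
  -- the tail: labels outside the cube are far
  have tailA : ∀ b : Fin 3 → ℤ, b ∉ (Fintype.piFinset fun _ : Fin 3 => Finset.Icc (-7 : ℤ) 7) → d₀ ≤ ‖latPt U hexFrame b‖ := by
    intro b hb
    have h6 : (6 : ℝ) ≤ ‖latPt 1 hexFrame b‖ := not_lt.1 fun h => hb (mem_box_of_norm_hexPt_lt h)
    have h34 := norm_apply_ge_of_norm_sub_one_le hU (latPt 1 hexFrame b)
    rw [← latPt_eq_apply_one] at h34
    linarith
  have tailB : ∀ b : Fin 3 → ℤ, b ∉ (Fintype.piFinset fun _ : Fin 3 => Finset.Icc (-7 : ℤ) 7) →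
      d₀ ≤ ‖latPt U hexFrame b + U (hcpShift + ξ)‖ := by
    intro b hb
    have h6 : (25 : ℝ) / 4 ≤ ‖latPt 1 hexFrame b + hcpShift‖ := not_lt.1 fun h => hb (mem_box_of_norm_hexPt_add_shift_lt h)
    have h34 := norm_apply_ge_of_norm_sub_one_le hU (latPt 1 hexFrame b + hcpShift + ξ)
    rw [← shifted_eq_apply] at h34
    have htri : ‖latPt 1 hexFrame b + hcpShift‖ - ‖ξ‖ ≤ ‖latPt 1 hexFrame b + hcpShift + ξ‖ := by
      have := norm_sub_le (latPt 1 hexFrame b + hcpShift + ξ) ξ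
      rw [add_sub_cancel_right] at this
      linarith
    nlinarith
  -- pinning of ALL structure points
  have hpinA : ∀ b : Fin 3 → ℤ, latPt U hexFrame b ≠ 0 → d₀ ≤ ‖latPt U hexFrame b‖ := by
    intro b hb0
    by_cases hb : b ∈ (Fintype.piFinset fun _ : Fin 3 => Finset.Icc (-7 : ℤ) 7)
    · have hb' : b ∈ box7all := by rw [box7all_eq]; exact hb
      obtain ⟨hA, -⟩ := hfar b hb'
      rcases hA with rfl | ⟨k, hk, he⟩ | hle
      · exact (hb0 (by simp [latPt])).elim
      · rw [← he, ← nbrU_of_unshifted hk]; exact hmin' k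
      · have hm := mem_qform13 U (hcpShift + ξ) hUG hUC hUT b false
        simp only [Bool.false_eq_true, ↓reduceIte, add_zero] at hm
        exact pin_of_lo hm hle (norm_nonneg _)
    · exact tailA b hb
  have hpinB : ∀ b : Fin 3 → ℤ, d₀ ≤ ‖latPt U hexFrame b + U (hcpShift + ξ)‖ := by
    intro b
    by_cases hb : b ∈ (Fintype.piFinset fun _ : Fin 3 => Finset.Icc (-7 : ℤ) 7)
    · have hb' : b ∈ box7all := by rw [box7all_eq]; exact hb
      obtain ⟨-, hB⟩ := hfar b hb'
      rcases hB with ⟨k, hk, he⟩ | hle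
      · rw [← he, ← nbrU_of_shifted hk]; exact hmin' k
      · have hm := mem_qform13 U (hcpShift + ξ) hUG hUC hUT b true
        simp only [↓reduceIte] at hm
        exact pin_of_lo hm hle (norm_nonneg _)
    · exact tailB b hb
  -- the radially misplaced neighbour `kw`
  have hw_lo : (1 + 1 / 8) * d₀ ≤ ‖nbrU U ξ kw‖ := by
    have h1 := (hnbr kw).1
    have e1 : (81 : ℝ) * ((Dhi : ℤ) : ℝ) ≤ 64 * ((nbrSq c w kw).lo : ℝ) := by exact_mod_cast hw1
    have h3 : (81 / 64 * d₀ ^ 2) * SC ≤ ‖nbrU U ξ kw‖ ^ 2 * SC := by nlinarith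
    have hsq : ((1 + 1 / 8) * d₀) ^ 2 ≤ ‖nbrU U ξ kw‖ ^ 2 := by
      have := le_of_mul_le_mul_right h3 hS
      nlinarith
    exact (abs_le_of_sq_le_sq' hsq (norm_nonneg _)).2
  have hw_hi : ‖nbrU U ξ kw‖ < 13 / 10 * d₀ := by
    have h2 := (hnbr kw).2
    have e1 : (100 : ℝ) * ((nbrSq c w kw).hi : ℝ) < 169 * ((Dlo : ℤ) : ℝ) := by exact_mod_cast hw2
    have h3 : ‖nbrU U ξ kw‖ ^ 2 * SC < (169 / 100 * d₀ ^ 2) * SC := by nlinarith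
    have hsq : ‖nbrU U ξ kw‖ ^ 2 < (13 / 10 * d₀) ^ 2 := by
      have := lt_of_mul_lt_mul_right h3 hS.le
      nlinarith
    exact (abs_lt_of_sq_lt_sq' hsq (by linarith)).2
  exact pruneHcp_of_radialBad (nbrU_structure U ξ kv) hv0 le_rfl (by linarith) hpinA hpinB (nbrU_structure U ξ kw) hw_lo hw_hi
    (by linarith)

/-! ## §3. Verdicts with the hcp radial prune and the `(H)` theorems -/

/-- ★ **NINE-COORDINATE hcp VERDICT WITH THE RADIAL PRUNE**: radial-bad (through the mirror) ∨ `entryLeafOKH3s μ` (sharp fit ∨ fit ∨ symmetry ∨ column ∨ (P4)). -/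
def entryLeafOKH3R (μ : ℤ) (c w : (Fin 3 × Fin 3) ⊕ Fin 3 → ℤ) : Bool := radOKH (symH c) (symH w) || entryLeafOKH3s μ c w

/-- ★ Soundness of `entryLeafOKH3R` (the `hver` shape of `…HomEntrySearch.hcpHalf_of_entrySearch`). [folklore] -/
theorem entryLeafOKH3R_sound {μ : ℤ} {c w : (Fin 3 × Fin 3) ⊕ Fin 3 → ℤ} (h : entryLeafOKH3R μ c w = true) (U : E3 →L[ℝ] E3) (ξ : E3)
    (hsa : ∀ v v' : E3, ⟪U v, v'⟫ = ⟪v, U v'⟫) (hU : ‖U - 1‖ ≤ 1 / 4)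
    (hbox : ∀ ab : Fin 3 × Fin 3, |(U (EuclideanSpace.single ab.2 (1 : ℝ))) ab.1 - (c (Sum.inl ab) : ℝ) / SC| ≤ (w (Sum.inl ab) : ℝ) / SC)
    (hξ : ∀ i : Fin 3, |ξ i - (c (Sum.inr i) : ℝ) / SC| ≤ (w (Sum.inr i) : ℝ) / SC) :
    (∀ (M : ℕ) (z : Fin M → E3) (c : Fin M), Function.Injective z →
        Set.range z = {x : E3 | dist x (z c) ≤ 133 / 10 ∧ ∃ a : Fin 3 → ℤ,
          x = z c + latPt U hexFrame a ∨ x = z c + latPt U hexFrame a + U (hcpShift + ξ)} →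
        TightNearCap (9 / 5) (3 / 2) z c ∨ ExemptNear (9 / 5) ExRec z c ∨ BadNearCap (9 / 5) (3 / 2) z c) ∨
      (μ : ℝ) / SC ≤ ∑ b ∈ (Fintype.piFinset fun _ : Fin 3 => Finset.Icc (-7 : ℤ) 7).filter (fun b => b ≠ 0), effPot w₄₅ ω₄ (3 / 400) ‖latPt U hexFrame b‖ +
        ∑ b ∈ (Fintype.piFinset fun _ : Fin 3 => Finset.Icc (-7 : ℤ) 7), effPot w₄₅ ω₄ (3 / 400) ‖latPt U hexFrame b + U (hcpShift + ξ)‖ := by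
  simp only [entryLeafOKH3R, Bool.or_eq_true] at h
  rcases h with h | h
  · exact Or.inl (radOKH_sound h U ξ hU (hbox_symU hsa hbox) hξ)
  · exact entryLeafOKH3s_sound h U ξ hsa hU hbox hξ

/-- ★★ The hcp half from ONE nine-coordinate search with the radial prune (any selector). [folklore] -/
theorem hcpHalf_of_entrySearchH3R {m : ℝ} {μ : ℤ} (hμ : 2 * (m + (-(7175 / 10000) + 3 / 400)) * SC ≤ μ)
    {sel : ℕ → ((Fin 3 × Fin 3) ⊕ Fin 3 → ℤ) → ((Fin 3 × Fin 3) ⊕ Fin 3 → ℤ) → (Fin 3 × Fin 3) ⊕ Fin 3} {fuel d : ℕ}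
    (h : searchOK (entryLeafOKH3R μ) sel fuel d rootCH rootWH = true) :
    ∀ (U : E3 →L[ℝ] E3) (ξ : E3), (∀ v w : E3, inner ℝ (U v) w = inner ℝ v (U w)) → (∀ w : E3, 0 ≤ inner ℝ w (U w)) →
      ‖U - 1‖ ≤ 1 / 4 → ‖ξ‖ ≤ 1 / 4 →
      (∀ (M : ℕ) (z : Fin M → E3) (c : Fin M), Function.Injective z →
          Set.range z = {x : E3 | dist x (z c) ≤ 133 / 10 ∧ ∃ a : Fin 3 → ℤ,
            x = z c + latPt U hexFrame a ∨ x = z c + latPt U hexFrame a + U (hcpShift + ξ)} →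
          TightNearCap (9 / 5) (3 / 2) z c ∨ ExemptNear (9 / 5) ExRec z c ∨ BadNearCap (9 / 5) (3 / 2) z c) ∨
      m ≤ (∑ b ∈ (Fintype.piFinset fun _ : Fin 3 => Finset.Icc (-7 : ℤ) 7).filter (fun b => b ≠ 0),
          effPot w₄₅ ω₄ (3 / 400) ‖latPt U hexFrame b‖ +
        ∑ b ∈ (Fintype.piFinset fun _ : Fin 3 => Finset.Icc (-7 : ℤ) 7),
          effPot w₄₅ ω₄ (3 / 400) ‖latPt U hexFrame b + U (hcpShift + ξ)‖) / 2 - (-(7175 / 10000) + 3 / 400) :=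
  hcpHalf_of_entrySearch hμ (entryLeafOKH3R μ) (fun _ _ hv U ξ hsa hU hbox hξ => entryLeafOKH3R_sound hv U ξ hsa hU hbox hξ) h

/-- ★★★ **`(H) HomFloor m` — fcc `entryLeafOK6R` (radial, six coordinates) × hcp `entryLeafOKH3R` (radial ∨ sharp fit, nine coordinates)**; every `m`, `μ`
with `2 (m + e_W) SC ≤ μ`, any selectors. [folklore] -/
theorem homFloor_of_entrySearches6R3R {m : ℝ} {μ : ℤ} (hμ : 2 * (m + (-(7175 / 10000) + 3 / 400)) * SC ≤ μ)
    {selF : ℕ → (Fin 3 × Fin 3 → ℤ) → (Fin 3 × Fin 3 → ℤ) → Fin 3 × Fin 3} {fuelF dF : ℕ}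
    (hF : searchOK (entryLeafOK6R μ) selF fuelF dF rootC rootW = true)
    {selH : ℕ → ((Fin 3 × Fin 3) ⊕ Fin 3 → ℤ) → ((Fin 3 × Fin 3) ⊕ Fin 3 → ℤ) → (Fin 3 × Fin 3) ⊕ Fin 3} {fuelH dH : ℕ}
    (hH : searchOK (entryLeafOKH3R μ) selH fuelH dH rootCH rootWH = true) : HomFloor m :=
  homFloor_of_prunedBoxSums_selfAdjoint (fccHalf_of_entrySearch6R hμ hF) (hcpHalf_of_entrySearchH3R hμ hH)

/-- ★★★ `HomFloor (1/625)` from `entryLeafOK6R muRec` × `entryLeafOKH3R muRec`. [folklore] -/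
theorem homFloor_625_of_entrySearches6R3R
    {selF : ℕ → (Fin 3 × Fin 3 → ℤ) → (Fin 3 × Fin 3 → ℤ) → Fin 3 × Fin 3} {fuelF dF : ℕ}
    (hF : searchOK (entryLeafOK6R muRec) selF fuelF dF rootC rootW = true)
    {selH : ℕ → ((Fin 3 × Fin 3) ⊕ Fin 3 → ℤ) → ((Fin 3 × Fin 3) ⊕ Fin 3 → ℤ) → (Fin 3 × Fin 3) ⊕ Fin 3} {fuelH dH : ℕ}
    (hH : searchOK (entryLeafOKH3R muRec) selH fuelH dH rootCH rootWH = true) : HomFloor (1 / 625) :=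
  homFloor_of_entrySearches6R3R muRec_ok hF hH

/-- ★★★ `HomFloor (1/1000)` from `entryLeafOK6R muMilli` × `entryLeafOKH3R muMilli`. [folklore] -/
theorem homFloor_milli_of_entrySearches6R3R
    {selF : ℕ → (Fin 3 × Fin 3 → ℤ) → (Fin 3 × Fin 3 → ℤ) → Fin 3 × Fin 3} {fuelF dF : ℕ}
    (hF : searchOK (entryLeafOK6R muMilli) selF fuelF dF rootC rootW = true)
    {selH : ℕ → ((Fin 3 × Fin 3) ⊕ Fin 3 → ℤ) → ((Fin 3 × Fin 3) ⊕ Fin 3 → ℤ) → (Fin 3 × Fin 3) ⊕ Fin 3} {fuelH dH : ℕ}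
    (hH : searchOK (entryLeafOKH3R muMilli) selH fuelH dH rootCH rootWH = true) : HomFloor (1 / 1000) :=
  homFloor_of_entrySearches6R3R muMilli_ok hF hH

/-- ★★★ `HomFloor (1/625)` with EVERY prune in the tree on both families: fcc `entryLeafOK6RB` (radial ∨ domain × best fit) × hcp `entryLeafOKH3R`. [folklore] -/
theorem homFloor_625_of_entrySearches6RB3R
    {selF : ℕ → (Fin 3 × Fin 3 → ℤ) → (Fin 3 × Fin 3 → ℤ) → Fin 3 × Fin 3} {fuelF dF : ℕ}
    (hF : searchOK (entryLeafOK6RB muRec) selF fuelF dF rootC rootW = true)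
    {selH : ℕ → ((Fin 3 × Fin 3) ⊕ Fin 3 → ℤ) → ((Fin 3 × Fin 3) ⊕ Fin 3 → ℤ) → (Fin 3 × Fin 3) ⊕ Fin 3} {fuelH dH : ℕ}
    (hH : searchOK (entryLeafOKH3R muRec) selH fuelH dH rootCH rootWH = true) : HomFloor (1 / 625) :=
  homFloor_of_prunedBoxSums_selfAdjoint (fccHalf_of_entrySearch6RB muRec_ok hF) (hcpHalf_of_entrySearchH3R muRec_ok hH)

/-- ★★★ `HomFloor (1/1000)` with every prune on both families. [folklore] -/
theorem homFloor_milli_of_entrySearches6RB3R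
    {selF : ℕ → (Fin 3 × Fin 3 → ℤ) → (Fin 3 × Fin 3 → ℤ) → Fin 3 × Fin 3} {fuelF dF : ℕ}
    (hF : searchOK (entryLeafOK6RB muMilli) selF fuelF dF rootC rootW = true)
    {selH : ℕ → ((Fin 3 × Fin 3) ⊕ Fin 3 → ℤ) → ((Fin 3 × Fin 3) ⊕ Fin 3 → ℤ) → (Fin 3 × Fin 3) ⊕ Fin 3} {fuelH dH : ℕ}
    (hH : searchOK (entryLeafOKH3R muMilli) selH fuelH dH rootCH rootWH = true) : HomFloor (1 / 1000) :=
  homFloor_of_prunedBoxSums_selfAdjoint (fccHalf_of_entrySearch6RB muMilli_ok hF) (hcpHalf_of_entrySearchH3R muMilli_ok hH)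

/-! ## §4. Kernel smoke test -/

/-- The entry/shuffle box (half-width `2⁻⁹` on all twelve coordinates) at the uniaxially stretched crystal `U = diag(1, 1, 31/25)`, `ξ = 0`: the six
`B`-neighbours are stretched to `≈ 1.165 d₀ ∈ [9/8, 13/10)·d₀` — radially bad on a COARSE box where no fit and no floor verdict can fire. -/
def stretchBox : (Fin 3 × Fin 3) ⊕ Fin 3 → ℤ := fun k =>
  match k with
  | Sum.inl (a, b) => if a = b then (if a = 2 then 349028971121213 else 281474976710656) else 0
  | Sum.inr _ => 0

/-- Kernel smoke test: `radOKH` fires on `stretchBox ± 2⁻⁹` and not on the root cube. -/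
example : radOKH stretchBox (fun _ => 549755813888) = true ∧ radOKH rootCH rootWH = false := by
  decide +kernel

end Summit.AtomisticToContinuum.Crystallization.Theorems.FrustratedLawDichotomyStrainedPatchHomEntryRadialHcp
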